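import Summits.BirchSwinnertonDyer.BirchSwinnertonDyer.Theorems.EisensteinPrimesCharLocalTameCorank
import HarnessLib

/-!
# `#H¹(K_{∞,w}, (F/𝒪)(θ))[p] ≤ p` at `v ∤ p` finitely decomposed — the `p`-torsion of the local factor
# is FINITE, for every `θ` with `θ^{p−1} = 1` (no hypothesis on `θ(Frob_v)` or on ramification)

Cell `bsd-eis` (home `run/shared/lean/pub/bsd-eis/`), seat `bsd-line-x1-p1-w2` (gen 1; D-0154 width
seat on crux 2 `GoodLatticeBDPValue` = stmt-BirchSwinnertonDyer-19032, line `halves` v16, stub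
`stub_imprimCorank` = `KellerYin2024.prop125_residualPair_unrSelmer_corank_ge`). Sequel of
`EisensteinPrimesCharLocalTameCount` / `…TameCorank` (the local factor of KY Lemma 1.1.1 has
`corank_{ℤ_p} = 1` when `θ(Frob_v) ≡ Nv`). The corank bookkeeping of the `≥` half of the
`S`-relaxation identity (`corank(Sel^{Sf}/Sel^∅) = Σ_{w∈Sf} Σ_{η∣w} corank H¹(K_{∞,η}, (F/𝒪)(θ))`
once the global-to-local map is onto; LEAD verdict v3.1 §3 items (vi)–(vii), both roads) needs the
tree's `zpCorank` to be ADDITIVE over the finite product of local factors (`zpCorank_pi`,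
`zpCorank_eq_add_of_shortExact`), which requires each factor to be `p`-primary with FINITE
`p`-torsion. This file supplies that finiteness, with the sharp bound, in the three local currencies:

* `natCard_pTorsion_subgroupH1_localSubgroup_charModule_le` — `Hi = localSubgroup (ker κ) K_v`:
  `#{x ∈ H¹(Hi, (F/𝒪)(θ)) : p x = 0} ≤ p` and the set is finite (Kummer count
  `KummerTorsionH1.natCard_nsmul_eq_zero_discreteH1_eq` + the tree's
  `NonsplitTower.finite_subgroupH1_and_natCard_le` on `M[p]`, `#M[p] = p` prime to the residue
  characteristic);
* `natCard_torsionBy_localH1_charModule_le` — **`#H¹(ker κ ⊓ D_v, (F/𝒪)(θ))[p] ≤ p`, finite**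
  (transport along `CharLocalTameCorank.nonempty_addEquiv_subgroupH1_inf_decomp`);
* `natCard_torsionBy_subgroupH1_kerD_charModule_le` — the `kerD κ v` twin.

HONEST FRAMING: tool theorems only (no definition, no named fact, no `sorry`); closes nothing by
itself (`--supports stmt-BirchSwinnertonDyer-19032`); BSD / Mazur's main conjecture / IMC is proved
for no curve by this file.

References: Keller–Yin arXiv:2402.12781v2 Lemma 1.1.1 (TeX L455–462); Greenberg, LNM 1716 §3
Lemma 3.3 (proof, p. 87: finiteness of `H¹(K_{∞,η}, E[p])`); Greenberg–Vatsal, Invent. Math. 142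
(2000) §2 Prop. (2.4); Serre, *Galois Cohomology* I §2.2.
-/

-- `Summit.BirchSwinnertonDyer.BirchSwinnertonDyer.…`: summit and sub-problem share a name (D-0017 layout).
set_option linter.dupNamespace false
set_option autoImplicit false

noncomputable section

open scoped Classical AddSubgroup Pointwise

open CategoryTheory Function Filter Polynomial NumberField IsDedekindDomain Field ValuativeRel WeierstrassCurve
open Literature.NumberTheory.EllipticCurves Literature.NumberTheory.EllipticCurves.GreenbergSelmer
  Literature.NumberTheory.GaloisRepresentations
  Literature.NumberTheory.GaloisRepresentations.IsNonarchimedeanLocalField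
  Literature.NumberTheory.EllipticCurves.KellerYin2024 Literature.NumberTheory.IwasawaTheory
  IsDedekindDomain.HeightOneSpectrum
  Summit.BirchSwinnertonDyer.Rank1Residual
  Summit.BirchSwinnertonDyer.Rank1Residual.X2.NonPrimitiveQuotientCorank
  Summit.BirchSwinnertonDyer.Rank1Residual.Iwasawa.NonsplitTower
  Summit.BirchSwinnertonDyer.Rank1Residual.X11b.Coinv
  Summit.BirchSwinnertonDyer.BirchSwinnertonDyer.Theorems.IwasawaTwoVariable
  Summit.BirchSwinnertonDyer.BirchSwinnertonDyer.Theorems.UnrSelmerQuotientTorsionFiniteChar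
  Summit.BirchSwinnertonDyer.BirchSwinnertonDyer.Theorems.KummerTorsionH1
  Summit.BirchSwinnertonDyer.BirchSwinnertonDyer.Theorems.CharLocalTameCount
  Summit.BirchSwinnertonDyer.BirchSwinnertonDyer.Theorems.CharLocalTameCorank

namespace Summit.BirchSwinnertonDyer.BirchSwinnertonDyer.Theorems.CharLocalTorsionBound

variable {K : Type} [Field K] [NumberField K] {p : ℕ} [hp : Fact p.Prime]
  (θ : FramedGaloisRep K (padicCoeffIntegers (∅ : Set (PadicAlgCl p))) 1) (κ : ZpExtension K p)
  {v : HeightOneSpectrum (𝓞 K)}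

/-! ## `#H¹[p] ≤ p` in the currencies `localSubgroup`, `ker κ ⊓ D_v`, `kerD` -/

/-- **`#{x ∈ H¹(Hi, (F/𝒪)(θ)) : p • x = 0} ≤ p`** (`Hi = Gal(K̄_v/K_{∞,w})`, any `ℤ_p`-extension, `v ∤ p`
not split completely in `K_∞`, `θ^{p−1} = 1`, ANY ramification / Frobenius behaviour of `θ` at `v`):
Kummer (`natCard_nsmul_eq_zero_discreteH1_eq`) and `#H¹(Hi, M[p]) ≤ #M[p] = p`
(`NonsplitTower.finite_subgroupH1_and_natCard_le`, `#M[p] = p` prime to the residue characteristic).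
The upper-bound half of KY Lemma 1.1.1 per place in the local currency (cf. the tree's inertia-side
`CharLocalInertiaBounds.natCard_torsionBy_discreteH1_inertiaIn_charModule_le`).
[cite: KellerYin2024, Lemma 1.1.1 (arXiv:2402.12781v2 TeX L455–462)] [cite: GreenbergLNM1716, §3 Lemma 3.3] -/
theorem natCard_pTorsion_subgroupH1_localSubgroup_charModule_le
    (hθ : ∀ σ : absoluteGaloisGroup K, θ σ ^ (p - 1) = 1) (hpv : (p : 𝓞 K) ∉ v.asIdeal)
    (hns : ∃ σ : absoluteGaloisGroup (v.adicCompletion K),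
      σ ∉ localSubgroup κ.kerSubgroup (v.adicCompletion K)) :
    letI : DistribMulAction (absoluteGaloisGroup (v.adicCompletion K))
        (charModule (∅ : Set (PadicAlgCl p)) θ) :=
      DistribMulAction.compHom _ (absGaloisRestrict K (v.adicCompletion K)).toMonoidHom
    Finite {x : Literature.NumberTheory.EllipticCurves.subgroupH1
        (localSubgroup κ.kerSubgroup (v.adicCompletion K)) (charModule (∅ : Set (PadicAlgCl p)) θ) //
      p • x = 0} ∧
    Nat.card {x : Literature.NumberTheory.EllipticCurves.subgroupH1
        (localSubgroup κ.kerSubgroup (v.adicCompletion K)) (charModule (∅ : Set (PadicAlgCl p)) θ) //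
      p • x = 0} ≤ p := by
  set M := charModule (∅ : Set (PadicAlgCl p)) θ with hM
  letI inst : DistribMulAction (absoluteGaloisGroup (v.adicCompletion K)) M :=
    DistribMulAction.compHom _ (absGaloisRestrict K (v.adicCompletion K)).toMonoidHom
  let Fv := v.adicCompletion K
  let G : Type := absoluteGaloisGroup Fv
  let Hi : Subgroup G := localSubgroup κ.kerSubgroup Fv
  let r : G →ₜ* absoluteGaloisGroup K := absGaloisRestrict K Fv
  let B : Type := ↥(M[(p : ℤ)])
  -- continuity of the orbit maps
  have hstab := GreenbergSelmer.isOpen_stabilizer_cofree (p := p) (∅ : Set (PadicAlgCl p)) θ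
  have hcontK : ∀ m : M, Continuous fun σ : absoluteGaloisGroup K ↦ σ • m := fun m ↦
    continuous_smul_of_isOpen_stabilizer m (hstab m)
  have hcont : ∀ m : M, Continuous fun g : G ↦ g • m := fun m ↦
    (hcontK m).comp r.continuous_toFun
  have hcontHi : ∀ m : M, Continuous fun g : Hi ↦ g • m := fun m ↦
    (hcont m).comp continuous_subtype_val
  -- Kummer
  have hinv : ∀ m : M, (∀ g : Hi, g • m = m) →
      ∃ m' : M, (∀ g : Hi, g • m' = m') ∧ p • m' = m := by
    intro m hm
    obtain ⟨m', hm', hpm'⟩ := exists_invariant_nsmul_eq_charModule θ hθ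
      (Set.range fun g : Hi ↦ r g) m (by rintro _ ⟨g, rfl⟩; exact hm g)
    exact ⟨m', fun g ↦ hm' _ ⟨g, rfl⟩, hpm'⟩
  have hK := natCard_nsmul_eq_zero_discreteH1_eq (Γ := Hi) (M := M) p hcontHi
    (exists_nsmul_eq_charModule θ) hinv
  -- `#H¹(Hi, M[p]) ≤ #M[p] = p`
  haveI : Finite B := finite_torsionBy_charModule (p := p) θ
  have hBp : ∀ b : B, p • b = 0 := fun b ↦
    Subtype.ext (by
      rw [AddSubgroupClass.coe_nsmul, ZeroMemClass.coe_zero]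
      exact AddSubgroup.torsionBy.nsmul_iff.mp b.2)
  have hB : ∃ k : ℕ, ∀ b : B, p ^ k • b = 0 := ⟨1, fun b ↦ by rw [pow_one]; exact hBp b⟩
  have hcontB : ∀ b : B, Continuous fun g : G ↦ g • b := fun b ↦ (hcont (b : M)).subtype_mk _
  have hBcard : (Nat.card B).Coprime (ringChar 𝓀[Fv]) := by
    rw [show Nat.card B = p from natCard_torsionBy_charModule (p := p) θ]
    exact (Nat.coprime_primes hp.out (ringChar_residueField_prime (F := Fv))).2
      (Ne.symm (v.ringChar_residueField_adicCompletion_ne hpv))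
  obtain ⟨hfin, hle⟩ := finite_subgroupH1_and_natCard_le κ hpv hns hB hBcard hcontB
  have hK' : Nat.card {x : Literature.NumberTheory.EllipticCurves.subgroupH1 Hi M // p • x = 0} =
      Nat.card (Literature.NumberTheory.EllipticCurves.subgroupH1 Hi B) := hK
  refine ⟨?_, ?_⟩
  · haveI := hfin
    refine Nat.finite_of_card_ne_zero ?_
    rw [hK']
    exact (Nat.card_pos (α := Literature.NumberTheory.EllipticCurves.subgroupH1 Hi B)).ne'
  · rw [hK']
    exact hle.trans (natCard_torsionBy_charModule (p := p) θ).le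

/-- **`#H¹(ker κ ⊓ D_v, (F/𝒪)(θ))[p] ≤ p` and the `p`-torsion is finite** (any `ℤ_p`-extension,
`v ∤ p` finitely decomposed, `θ^{p−1} = 1`; no hypothesis on `θ(Frob_v)` or on the ramification of
`θ` at `v`) — transport of `natCard_pTorsion_subgroupH1_localSubgroup_charModule_le` along §1. The
finiteness is what the corank bookkeeping over the places `w ∈ Sf` consumes (`zpCorank` is additive
on finite products of `p`-primary groups with finite `p`-torsion).
[cite: KellerYin2024, Lemma 1.1.1 (arXiv:2402.12781v2 TeX L455–462)] [cite: GreenbergLNM1716, §3 Lemma 3.3] -/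
theorem natCard_torsionBy_localH1_charModule_le (hθ : ∀ σ : absoluteGaloisGroup K, θ σ ^ (p - 1) = 1)
    (hpv : (p : 𝓞 K) ∉ v.asIdeal) (hD : ¬ (decomp v ≤ κ.kerSubgroup)) :
    Finite ((Literature.NumberTheory.EllipticCurves.subgroupH1 (κ.kerSubgroup ⊓ decomp v)
      (charModule (∅ : Set (PadicAlgCl p)) θ))[(p : ℤ)]) ∧
    Nat.card ((Literature.NumberTheory.EllipticCurves.subgroupH1 (κ.kerSubgroup ⊓ decomp v)
      (charModule (∅ : Set (PadicAlgCl p)) θ))[(p : ℤ)]) ≤ p := by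
  letI inst : DistribMulAction (absoluteGaloisGroup (v.adicCompletion K))
      (charModule (∅ : Set (PadicAlgCl p)) θ) :=
    DistribMulAction.compHom _ (absGaloisRestrict K (v.adicCompletion K)).toMonoidHom
  obtain ⟨e⟩ := nonempty_addEquiv_subgroupH1_inf_decomp κ.kerSubgroup
    (charModule (∅ : Set (PadicAlgCl p)) θ) v
  obtain ⟨hfin, hle⟩ := natCard_pTorsion_subgroupH1_localSubgroup_charModule_le θ κ hθ hpv
    (exists_not_mem_localSubgroup_of_not_decomp_le κ hD)
  -- `A[p] ≃ {y : C // p • y = 0}` along `e`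
  have ε : ↥((Literature.NumberTheory.EllipticCurves.subgroupH1 (κ.kerSubgroup ⊓ decomp v)
      (charModule (∅ : Set (PadicAlgCl p)) θ))[(p : ℤ)]) ≃
      {y : Literature.NumberTheory.EllipticCurves.subgroupH1
        (localSubgroup κ.kerSubgroup (v.adicCompletion K)) (charModule (∅ : Set (PadicAlgCl p)) θ) //
        p • y = 0} :=
    { toFun := fun x ↦ ⟨e x, by
        rw [← map_nsmul, AddSubgroup.torsionBy.nsmul_iff.mp x.2, map_zero]⟩
      invFun := fun y ↦ ⟨e.symm y, AddSubgroup.torsionBy.nsmul_iff.mpr (by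
        rw [← map_nsmul, y.2, map_zero])⟩
      left_inv := fun x ↦ Subtype.ext (e.symm_apply_apply _)
      right_inv := fun y ↦ Subtype.ext (e.apply_symm_apply _) }
  haveI := hfin
  exact ⟨Finite.of_equiv _ ε.symm, (Nat.card_congr ε).trans_le hle⟩

/-- `kerD` twin of `natCard_torsionBy_localH1_charModule_le`: **`#H¹(kerD κ v, (F/𝒪)(θ))[p] ≤ p`**, finite.
[cite: KellerYin2024, Lemma 1.1.1 (arXiv:2402.12781v2 TeX L455–462)] -/
theorem natCard_torsionBy_subgroupH1_kerD_charModule_le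
    (hθ : ∀ σ : absoluteGaloisGroup K, θ σ ^ (p - 1) = 1)
    (hpv : (p : 𝓞 K) ∉ v.asIdeal) (hD : ¬ (decomp v ≤ κ.kerSubgroup)) :
    Finite ((Literature.NumberTheory.EllipticCurves.subgroupH1 (kerD κ v)
      (charModule (∅ : Set (PadicAlgCl p)) θ))[(p : ℤ)]) ∧
    Nat.card ((Literature.NumberTheory.EllipticCurves.subgroupH1 (kerD κ v)
      (charModule (∅ : Set (PadicAlgCl p)) θ))[(p : ℤ)]) ≤ p := by
  obtain ⟨e⟩ := nonempty_addEquiv_subgroupH1_kerD κ (charModule (∅ : Set (PadicAlgCl p)) θ) v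
  obtain ⟨hfin, hle⟩ := natCard_torsionBy_localH1_charModule_le θ κ hθ hpv hD
  haveI := hfin
  let ε := (torsionByEquiv e p).toEquiv
  exact ⟨Finite.of_equiv _ ε.symm, (Nat.card_congr ε).trans_le hle⟩

end Summit.BirchSwinnertonDyer.BirchSwinnertonDyer.Theorems.CharLocalTorsionBound

end
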